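import Summits.CriticalPhenomena.CardyFormulaZ2.Theorems.CardySusyWardParafermionFamiliesToSLESixAnchorFamily
import Literature.Probability.Percolation.FourArmGarbanSquareDomain

/-!
# The strip anchor (stub S5 of line `strip-anchored-vertex-normalisation`, crux stmt-CriticalPhenomena-10814), III:
# the lattice geometry of the anchor square at mesh `δ`

Helper file for `stub_anchoredWallFlux` (stub GEOMETRY, part 1: pure lattice geometry; part 2 is
`…AnchorGeometry.lean`). For the anchor Dobrushin domain `anchorDomain = {|x + y| < 2, |x - y| < 2}` of
`…AnchorFamily.lean`, a mesh `δ > 0` and the integer `L` with `L δ < 2 ≤ (L + 1) δ` (`L = ⌈2/δ⌉ - 1`, the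
level `x₀ + x₁ = L` of the last lattice diagonal inside the square), in the coordinates `s = v₀ + v₁`
(level) and `d = v₀ - v₁` (column) of a site `v : Site 2`:

* `mem_meshVertices_anchor_iff`, `mem_meshDomain_anchor_iff`: the mesh vertices, and the discrete domain
  `Ω_δ = meshDomain` ("largest component": the mesh vertex graph of the diamond is connected,
  `meshVertexGraph_anchor_preconnected`, by monotone lattice paths to the origin), are the lattice
  diamond `{|s| ≤ L, |d| ≤ L}` (an `ℓ¹`-ball of `ℤ²`);
* `adj_anchor`, `discreteDomainGraph_anchor_adj_iff`: lattice neighbours of the diamond are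
  `Ω_δ`-adjacent (the square is convex, `convex_anchorDomain_carrier`);
* `isInnerFace_anchor_iff`: for Dobrushin data `E` on the anchor at mesh `δ`, the face with lower-left
  corner `f` is inner iff `|f₀ + f₁ + 1| < L ∧ |f₀ - f₁| < L`;
* `mem_zdBoundary_anchor_iff`: its discrete boundary `E.zdBoundary` is the layer
  `{L - 1 ≤ |s| ∨ L - 1 ≤ |d|}` of the diamond — the outer layer `|s| = L ∨ |d| = L` is the vertex
  boundary, the next one consists of the concave lattice corners of the four boundary staircases
  (`mem_zdBoundary_of_isInnerFace_of_not`: a corner of an inner and of a non-inner face is a boundary site).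

Registered one-line form: `stub_anchor_meshDomain`.
-/

noncomputable section

namespace Summit.CriticalPhenomena.CardyFormulaZ2.Theorems.ParafermionFamiliesToSLESix.StripAnchored

open Set Metric Complex
open Literature.Probability.LatticeModels
open Literature.Probability.LatticeModels.DiscreteDobrushin (IsOutEdge IsInEdge)
open Literature.Probability.RandomPlanarGeometry
open Literature.Probability.Percolation (meshDomain_eq_meshVertices_of_preconnected)

namespace S5

/-! ## The anchor square is convex; its mesh vertices form the lattice diamond -/

/-- The carrier of the anchor is the image of the axis square `(-1,1)²` under `z ↦ -(1+i) z`. [folklore] -/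
theorem anchorDomain_carrier_eq : anchorDomain.carrier = rotHomeo '' symRect 1 1 := by
  rw [anchorDomain, MarkedDomain.carrier_map]; rfl

/-- The anchor square is convex. [folklore] -/
theorem convex_anchorDomain_carrier : Convex ℝ anchorDomain.carrier := by
  rw [anchorDomain_carrier_eq]
  refine (convex_symRect 1 1).is_linear_image ⟨fun x y => ?_, fun c x => ?_⟩
  · simp only [rotHomeo_apply, mul_add]
  · simp only [rotHomeo_apply, mul_smul_comm]

variable {δ : ℝ} {L : ℤ}

/-- Rounding: for an integer `s`, `|δ s| < 2 ↔ |s| ≤ L` when `L δ < 2 ≤ (L + 1) δ`. [folklore] -/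
theorem anchor_abs_mul_lt_two_iff (hδ : 0 < δ) (hLδ : (L : ℝ) * δ < 2) (hL1 : 2 ≤ ((L : ℝ) + 1) * δ)
    (s : ℤ) : |δ * (s : ℝ)| < 2 ↔ |s| ≤ L := by
  rw [abs_mul, abs_of_pos hδ, ← Int.cast_abs]
  constructor
  · intro h
    by_contra hlt
    have h' : (L : ℝ) + 1 ≤ ((|s| : ℤ) : ℝ) := by exact_mod_cast Int.add_one_le_iff.2 (not_le.1 hlt)
    nlinarith
  · intro h
    have h' : ((|s| : ℤ) : ℝ) ≤ L := by exact_mod_cast h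
    have h0 : (0 : ℝ) ≤ ((|s| : ℤ) : ℝ) := by exact_mod_cast abs_nonneg s
    nlinarith

/-- `0 ≤ L` for such an `L`. [folklore] -/
theorem anchor_level_nonneg (hδ : 0 < δ) (hL1 : 2 ≤ ((L : ℝ) + 1) * δ) : 0 ≤ L := by
  by_contra h
  have h' : (L : ℝ) + 1 ≤ 0 := by exact_mod_cast Int.add_one_le_iff.2 (not_le.1 h)
  nlinarith

/-- **The mesh vertices of the anchor square are the lattice diamond** `{|v₀ + v₁| ≤ L, |v₀ - v₁| ≤ L}`.
[folklore] -/
theorem mem_meshVertices_anchor_iff (hδ : 0 < δ) (hLδ : (L : ℝ) * δ < 2) (hL1 : 2 ≤ ((L : ℝ) + 1) * δ)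
    (v : Site 2) : v ∈ meshVertices anchorDomain.carrier δ ↔ |v 0 + v 1| ≤ L ∧ |v 0 - v 1| ≤ L := by
  rw [mem_meshVertices_iff, mem_anchorDomain_carrier, meshPoint_re, meshPoint_im, ← mul_add, ← mul_sub,
    ← Int.cast_add, ← Int.cast_sub, anchor_abs_mul_lt_two_iff hδ hLδ hL1,
    anchor_abs_mul_lt_two_iff hδ hLδ hL1]

/-- Lattice neighbours among the mesh vertices are mesh-adjacent (the joining segment stays in the
convex square). [folklore] -/
theorem meshGraph_adj_anchor {x y : Site 2} (hx : x ∈ meshVertices anchorDomain.carrier δ)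
    (hy : y ∈ meshVertices anchorDomain.carrier δ) (hxy : (zdGraph 2).Adj x y) :
    (meshGraph anchorDomain.carrier δ).Adj x y :=
  meshGraph_adj_iff.2 ⟨hxy, (convex_anchorDomain_carrier.segment_subset hx hy).trans subset_closure⟩

/-- The origin is a mesh vertex. [folklore] -/
theorem zero_mem_meshVertices_anchor (hδ : 0 < δ) (hLδ : (L : ℝ) * δ < 2)
    (hL1 : 2 ≤ ((L : ℝ) + 1) * δ) : (0 : Site 2) ∈ meshVertices anchorDomain.carrier δ := by
  rw [mem_meshVertices_anchor_iff hδ hLδ hL1]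
  have := anchor_level_nonneg hδ hL1
  simpa using this

-- adapted from `Literature/Probability/LatticeModels/PlanarIsingDiscApprox.lean` (`reachable_zero`)
/-- Every mesh vertex of the anchor square is joined to the origin inside the mesh vertex graph
(monotone lattice path towards `0`: the diamond is an `ℓ¹`-ball). [folklore] -/
theorem reachable_zero_anchor (hδ : 0 < δ) (hLδ : (L : ℝ) * δ < 2) (hL1 : 2 ≤ ((L : ℝ) + 1) * δ)
    (v : Site 2) (hv : v ∈ meshVertices anchorDomain.carrier δ) :
    (meshVertexGraph anchorDomain.carrier δ).Reachable ⟨v, hv⟩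
      ⟨0, zero_mem_meshVertices_anchor hδ hLδ hL1⟩ := by
  suffices key : ∀ n : ℕ, ∀ (v : Site 2) (hv : v ∈ meshVertices anchorDomain.carrier δ),
      (v 0).natAbs + (v 1).natAbs = n →
      (meshVertexGraph anchorDomain.carrier δ).Reachable ⟨v, hv⟩
        ⟨0, zero_mem_meshVertices_anchor hδ hLδ hL1⟩ from key _ v hv rfl
  intro n
  induction n with
  | zero =>
    intro v hv hn
    have : v = 0 := by
      funext i
      fin_cases i
      · simp only [Fin.zero_eta, Pi.zero_apply]; omega
      · simp only [Fin.mk_one, Pi.zero_apply]; omega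
    subst this
    rfl
  | succ n ih =>
    intro v hv hn
    have hv' := (mem_meshVertices_anchor_iff hδ hLδ hL1 v).1 hv
    obtain ⟨i, hi⟩ : ∃ i : Fin 2, v i ≠ 0 := by
      by_contra hcon
      have h : ∀ i, v i = 0 := fun i => by_contra fun h => hcon ⟨i, h⟩
      rw [h 0, h 1] at hn
      simp at hn
    -- one step towards the origin in the `i`-th coordinate
    obtain ⟨w, hadj, habs, hwj⟩ : ∃ w : Site 2, (zdGraph 2).Adj v w ∧
        (w i).natAbs + 1 = (v i).natAbs ∧ ∀ j, j ≠ i → w j = v j := by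
      rcases lt_or_gt_of_ne hi with hneg | hpos
      · refine ⟨v + Pi.single i 1, (zdGraph_adj_iff _ _).2 ⟨i, Or.inl rfl⟩, ?_,
          fun j hj => by simp [hj]⟩
        simp only [Pi.add_apply, Pi.single_eq_same]
        omega
      · refine ⟨v - Pi.single i 1, (zdGraph_adj_iff _ _).2 ⟨i, Or.inr (by simp)⟩, ?_,
          fun j hj => by simp [hj]⟩
        simp only [Pi.sub_apply, Pi.single_eq_same]
        omega
    have hle : ∀ j, (w j).natAbs ≤ (v j).natAbs := by
      intro j
      by_cases hj : j = i
      · subst hj; omega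
      · rw [hwj j hj]
    have hwmem : w ∈ meshVertices anchorDomain.carrier δ := by
      rw [mem_meshVertices_anchor_iff hδ hLδ hL1]
      have h0 := hle 0
      have h1 := hle 1
      simp only [Int.abs_eq_natAbs] at hv' ⊢
      omega
    have hn' : (w 0).natAbs + (w 1).natAbs = n := by
      fin_cases i
      · have h1 := hwj 1 (by decide)
        simp only [Fin.zero_eta] at habs
        rw [h1]; omega
      · have h0 := hwj 0 (by decide)
        simp only [Fin.mk_one] at habs
        rw [h0]; omega
    have hadj' : (meshVertexGraph anchorDomain.carrier δ).Adj ⟨v, hv⟩ ⟨w, hwmem⟩ :=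
      SimpleGraph.induce_adj.2 (meshGraph_adj_anchor hv hwmem hadj)
    exact hadj'.reachable.trans (ih w hwmem hn')

/-- **The mesh vertex graph of the anchor square is connected.** [folklore] -/
theorem meshVertexGraph_anchor_preconnected (hδ : 0 < δ) (hLδ : (L : ℝ) * δ < 2)
    (hL1 : 2 ≤ ((L : ℝ) + 1) * δ) : (meshVertexGraph anchorDomain.carrier δ).Preconnected :=
  fun u v => (reachable_zero_anchor hδ hLδ hL1 u.1 u.2).trans (reachable_zero_anchor hδ hLδ hL1 v.1 v.2).symm

/-- The discrete domain of the anchor square is the whole set of mesh vertices. [folklore] -/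
theorem meshDomain_anchor_eq (hδ : 0 < δ) (hLδ : (L : ℝ) * δ < 2) (hL1 : 2 ≤ ((L : ℝ) + 1) * δ) :
    meshDomain anchorDomain.carrier δ = meshVertices anchorDomain.carrier δ :=
  meshDomain_eq_meshVertices_of_preconnected (meshVertexGraph_anchor_preconnected hδ hLδ hL1)

/-- **The discrete domain `Ω_δ` of the anchor square is the lattice diamond**
`{|v₀ + v₁| ≤ L, |v₀ - v₁| ≤ L}`. [folklore] -/
theorem mem_meshDomain_anchor_iff (hδ : 0 < δ) (hLδ : (L : ℝ) * δ < 2) (hL1 : 2 ≤ ((L : ℝ) + 1) * δ)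
    (v : Site 2) : v ∈ meshDomain anchorDomain.carrier δ ↔ |v 0 + v 1| ≤ L ∧ |v 0 - v 1| ≤ L := by
  rw [meshDomain_anchor_eq hδ hLδ hL1, mem_meshVertices_anchor_iff hδ hLδ hL1]

/-- **Lattice neighbours of `Ω_δ` are `Ω_δ`-adjacent** (convexity). [folklore] -/
theorem adj_anchor (v u : Site 2) (hv : v ∈ meshDomain anchorDomain.carrier δ)
    (hu : u ∈ meshDomain anchorDomain.carrier δ) (hvu : (zdGraph 2).Adj v u) :
    (discreteDomainGraph anchorDomain.carrier δ).Adj v u :=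
  discreteDomainGraph_adj_iff.2 ⟨meshGraph_adj_anchor (meshDomain_subset_meshVertices _ _ hv)
    (meshDomain_subset_meshVertices _ _ hu) hvu, hv, hu⟩

/-- Adjacency in `Ω_δ`: lattice adjacency between sites of the diamond. [folklore] -/
theorem discreteDomainGraph_anchor_adj_iff (hδ : 0 < δ) (hLδ : (L : ℝ) * δ < 2)
    (hL1 : 2 ≤ ((L : ℝ) + 1) * δ) {x y : Site 2} :
    (discreteDomainGraph anchorDomain.carrier δ).Adj x y ↔ (zdGraph 2).Adj x y ∧
      (|x 0 + x 1| ≤ L ∧ |x 0 - x 1| ≤ L) ∧ (|y 0 + y 1| ≤ L ∧ |y 0 - y 1| ≤ L) := by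
  rw [← mem_meshDomain_anchor_iff hδ hLδ hL1 x, ← mem_meshDomain_anchor_iff hδ hLδ hL1 y]
  constructor
  · intro h
    have h' := discreteDomainGraph_adj_iff.1 h
    exact ⟨(meshGraph_adj_iff.1 h'.1).1, h'.2.1, h'.2.2⟩
  · rintro ⟨h, hx, hy⟩
    exact adj_anchor x y hx hy h

/-! ## Inner faces and the discrete boundary -/

/-- `f + eᵢ` is a corner of the face `f`. [folklore] -/
theorem anchor_isCorner_add_single (f : Site 2) (i : Fin 2) : IsCorner (f + Pi.single i 1) f := by
  intro j
  by_cases h : j = i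
  · subst h; right; simp
  · left; simp [h]

/-- `f + e₀ + e₁` is a corner of the face `f`. [folklore] -/
theorem anchor_isCorner_add_add (f : Site 2) : IsCorner (f + Pi.single 0 1 + Pi.single 1 1) f := by
  intro j
  right
  fin_cases j <;> simp

variable {E : DiscreteDobrushin}

/-- **The inner faces of the anchor data**: the face with lower-left corner `f` is inner iff its four
corners (levels `s, s+1, s+1, s+2`, columns `d, d+1, d-1, d`, `s = f₀ + f₁`, `d = f₀ - f₁`) lie in the
diamond, i.e. `|f₀ + f₁ + 1| < L ∧ |f₀ - f₁| < L`. [folklore] -/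
theorem isInnerFace_anchor_iff (hΩ : E.Ω = anchorDomain.carrier) (hE : E.δ = δ) (hδ : 0 < δ)
    (hLδ : (L : ℝ) * δ < 2) (hL1 : 2 ≤ ((L : ℝ) + 1) * δ) (f : Site 2) :
    E.IsInnerFace f ↔ |f 0 + f 1 + 1| < L ∧ |f 0 - f 1| < L := by
  unfold DiscreteDobrushin.IsInnerFace
  rw [hΩ, hE]
  simp only [discreteDomainGraph_anchor_adj_iff hδ hLδ hL1]
  constructor
  · intro h
    obtain ⟨-, ⟨ha1, ha2⟩, hb1, hb2⟩ := h f (f + Pi.single 0 1) (isCorner_self f)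
      (anchor_isCorner_add_single f 0) ((zdGraph_adj_iff _ _).2 ⟨0, Or.inl rfl⟩)
    obtain ⟨-, -, hc1, hc2⟩ := h f (f + Pi.single 1 1) (isCorner_self f)
      (anchor_isCorner_add_single f 1) ((zdGraph_adj_iff _ _).2 ⟨1, Or.inl rfl⟩)
    obtain ⟨-, -, hd1, hd2⟩ := h (f + Pi.single 0 1) (f + Pi.single 0 1 + Pi.single 1 1)
      (anchor_isCorner_add_single f 0) (anchor_isCorner_add_add f)
      ((zdGraph_adj_iff _ _).2 ⟨1, Or.inl rfl⟩)
    simp only [Pi.add_apply, Pi.single_eq_same, ne_eq, one_ne_zero, not_false_eq_true,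
      Pi.single_eq_of_ne, zero_ne_one, add_zero] at hb1 hb2 hc1 hc2 hd1 hd2
    simp only [Int.abs_eq_natAbs] at *
    omega
  · rintro ⟨hs, hd⟩ v w hv hw hadj
    have hv0 := hv 0
    have hv1 := hv 1
    have hw0 := hw 0
    have hw1 := hw 1
    simp only [Int.abs_eq_natAbs] at *
    refine ⟨hadj, ?_, ?_⟩ <;> omega

/-- **A corner of an inner face and of a non-inner face is a boundary site**: going around the site,
two cyclically consecutive faces differ, and the lattice edge between them (an edge of `Ω_δ`, being a
side of the inner one) is a face-boundary edge. [folklore] -/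
theorem mem_zdBoundary_of_isInnerFace_of_not {x : Site 2} {k₁ k₂ : Fin 4}
    (h₁ : E.IsInnerFace (faceAt x k₁)) (h₂ : ¬ E.IsInnerFace (faceAt x k₂)) : x ∈ E.zdBoundary := by
  classical
  have key : ∀ (b : Fin 4 → Bool) (k₁ k₂ : Fin 4), b k₁ = true → b k₂ = false →
      ∃ k, (b k = true ∧ b (k + 3) = false) ∨ (b (k + 3) = true ∧ b k = false) := by decide
  obtain ⟨k, hk⟩ := key (fun k => decide (E.IsInnerFace (faceAt x k))) k₁ k₂
    (by simpa using h₁) (by simpa using h₂)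
  simp only [decide_eq_true_eq, decide_eq_false_iff_not] at hk
  rcases hk with hk | hk
  · exact E.mem_zdBoundary_iff.2 (Or.inr ⟨_, (show IsOutEdge E x k from hk).isFaceBoundaryEdge⟩)
  · exact E.mem_zdBoundary_iff.2 (Or.inr ⟨_, (show IsInEdge E x k from hk).isFaceBoundaryEdge⟩)

/-- **The discrete boundary of the anchor data** (`L ≥ 2`) is the layer `L - 1 ≤ |s| ∨ L - 1 ≤ |d|` of the
diamond: the outer layer `|s| = L ∨ |d| = L` has lattice neighbours outside `Ω_δ` (vertex boundary); a
site of the next layer is a concave corner — a corner of a non-inner face (towards the boundary) and of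
an inner face (towards the origin); a site with `|s|, |d| ≤ L - 2` has its four neighbours in `Ω_δ` and
its four faces inner. [folklore] -/
theorem mem_zdBoundary_anchor_iff (hΩ : E.Ω = anchorDomain.carrier) (hE : E.δ = δ) (hδ : 0 < δ)
    (hL : 2 ≤ L) (hLδ : (L : ℝ) * δ < 2) (hL1 : 2 ≤ ((L : ℝ) + 1) * δ) (v : Site 2) :
    v ∈ E.zdBoundary ↔
      (|v 0 + v 1| ≤ L ∧ |v 0 - v 1| ≤ L) ∧ (L - 1 ≤ |v 0 + v 1| ∨ L - 1 ≤ |v 0 - v 1|) := by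
  have hinner := isInnerFace_anchor_iff hΩ hE hδ hLδ hL1
  have hdom := mem_meshDomain_anchor_iff hδ hLδ hL1 (L := L)
  have hvdom_iff : v ∈ meshDomain E.Ω E.δ ↔ |v 0 + v 1| ≤ L ∧ |v 0 - v 1| ≤ L := by rw [hΩ, hE, hdom]
  constructor
  · intro h
    have hvdom := E.zdBoundary_subset_meshDomain h
    refine ⟨hvdom_iff.1 hvdom, ?_⟩
    by_contra hfar
    have hvd := hvdom_iff.1 hvdom
    rcases h with hx | ⟨y, -, -, f, hf, hxf, -⟩
    · rw [mem_meshBoundary_iff] at hx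
      obtain ⟨-, y, hxy, hnadj⟩ := hx
      apply hnadj
      rw [hΩ, hE] at hvdom ⊢
      refine adj_anchor _ _ hvdom ?_ hxy
      rw [hdom]
      obtain ⟨i, hi | hi⟩ := (zdGraph_adj_iff _ _).1 hxy
      · subst hi
        fin_cases i <;> simp <;> simp only [Int.abs_eq_natAbs] at * <;> omega
      · obtain rfl : y = v - Pi.single i 1 := eq_sub_of_add_eq hi.symm
        fin_cases i <;> simp <;> simp only [Int.abs_eq_natAbs] at * <;> omega
    · rw [hinner] at hf
      have c0 := hxf 0
      have c1 := hxf 1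
      simp only [Int.abs_eq_natAbs] at *
      omega
  · rintro ⟨⟨hs, hd⟩, hnear⟩
    have hvdom : v ∈ meshDomain E.Ω E.δ := hvdom_iff.2 ⟨hs, hd⟩
    by_cases hout : L ≤ |v 0 + v 1| ∨ L ≤ |v 0 - v 1|
    · -- outer layer: a lattice neighbour outside `Ω_δ`
      refine E.mem_zdBoundary_iff.2 (Or.inl (mem_meshBoundary_iff.2 ⟨hvdom, ?_⟩))
      rw [hΩ, hE]
      by_cases hplus : v 0 + v 1 = L ∨ v 0 - v 1 = L
      · refine ⟨v + Pi.single 0 1, (zdGraph_adj_iff _ _).2 ⟨0, Or.inl rfl⟩, fun h => ?_⟩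
        have hy := (hdom _).1 (discreteDomainGraph_adj_iff.1 h).2.2
        simp at hy
        simp only [Int.abs_eq_natAbs] at *
        omega
      · refine ⟨v - Pi.single 0 1, (zdGraph_adj_iff _ _).2 ⟨0, Or.inr (by simp)⟩, fun h => ?_⟩
        have hy := (hdom _).1 (discreteDomainGraph_adj_iff.1 h).2.2
        simp at hy
        simp only [Int.abs_eq_natAbs] at *
        omega
    · -- next layer: a concave lattice corner
      -- coordinates of the four faces around `v` (`faceAt_apply` of `…InnerCycleSteps.lean`, inlined)
      obtain ⟨⟨a0, a1⟩, ⟨b0, b1⟩, ⟨c0, c1⟩, ⟨d0, d1⟩⟩ :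
          (faceAt v 0 0 = v 0 ∧ faceAt v 0 1 = v 1) ∧ (faceAt v 1 0 = v 0 - 1 ∧ faceAt v 1 1 = v 1) ∧
            (faceAt v 2 0 = v 0 - 1 ∧ faceAt v 2 1 = v 1 - 1) ∧
            (faceAt v 3 0 = v 0 ∧ faceAt v 3 1 = v 1 - 1) := by
        simp [faceAt, cornerOff]
      have h0 := hinner (faceAt v 0)
      have h1 := hinner (faceAt v 1)
      have h2 := hinner (faceAt v 2)
      have h3 := hinner (faceAt v 3)
      rw [a0, a1] at h0
      rw [b0, b1] at h1
      rw [c0, c1] at h2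
      rw [d0, d1] at h3
      simp only [abs_le, abs_lt, le_abs'] at hs hd hnear hout h0 h1 h2 h3
      have hin : E.IsInnerFace (faceAt v 0) ∨ E.IsInnerFace (faceAt v 2) := by
        rw [h0, h2]
        omega
      have hout' : ¬ E.IsInnerFace (faceAt v 0) ∨ ¬ E.IsInnerFace (faceAt v 1) ∨
          ¬ E.IsInnerFace (faceAt v 2) ∨ ¬ E.IsInnerFace (faceAt v 3) := by
        rw [h0, h1, h2, h3]
        omega
      rcases hin with hin | hin <;> rcases hout' with hout' | hout' | hout' | hout' <;>
        exact mem_zdBoundary_of_isInnerFace_of_not hin hout'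

end S5

open S5 in
/-- **Registered one-line form `stub_anchor_meshDomain`** (helper of stub S5 `stub_anchoredWallFlux`,
stub GEOMETRY part 1): at a mesh `δ` with `L δ < 2 ≤ (L + 1) δ` the discrete domain `Ω_δ` of the anchor
square is the lattice diamond `{|v₀ + v₁| ≤ L, |v₀ - v₁| ≤ L}`. [folklore] -/
theorem stub_anchor_meshDomain : ∀ (δ : ℝ) (L : ℤ), 0 < δ → (L : ℝ) * δ < 2 → 2 ≤ ((L : ℝ) + 1) * δ → ∀ v : Site 2, v ∈ meshDomain anchorDomain.carrier δ ↔ |v 0 + v 1| ≤ L ∧ |v 0 - v 1| ≤ L :=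
  fun _ _ hδ hLδ hL1 v => mem_meshDomain_anchor_iff hδ hLδ hL1 v

end Summit.CriticalPhenomena.CardyFormulaZ2.Theorems.ParafermionFamiliesToSLESix.StripAnchored

end
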